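import Summits.BirchSwinnertonDyer.BirchSwinnertonDyer.Theorems.SignedLowerHalvesSmallImageLowerHalfBothSignsRttD2SpecialisationHK
import Summits.BirchSwinnertonDyer.BirchSwinnertonDyer.Theorems.SignedLowerHalvesSmallImageLowerHalfBothSignsRttD2SpecialisationSwap
import Literature.NumberTheory.EllipticCurves.IwasawaSelmerIsTorsionProofs
import HarnessLib

/-!
# Route `SignedLowerHalves`, crux L `SmallImageLowerHalfBothSigns` (item stmt-BirchSwinnertonDyer-23599), line `rtt_w3` v13 — E2, row D2-b: the glue's `hK`
# LITERALLY — `lambdaInvariant p (Hsp ⧸ Λ_𝒪∙z) ≤ lambdaInvariant p Ysp` — from JLK's `Thm52Shape` specialised along `φ_b`, when the specialised zeta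
# module `ZSp = Z̄` is cyclic on `z` and the defect `(H¹ ⧸ Z)[f]` vanishes

Width seat `bsd-line-slh-p3-w3` g19 under LEAD `cruxlead-stmt-BirchSwinnertonDyer-23599` g9 (GO 14:01:41Z, D2 DEFINER (D2-b)); ROUTE-INDEPENDENT helper
(`--supports stmt-BirchSwinnertonDyer-23599`); THEOREMS ONLY — no definition, no named fact, no instance, no `sorry`; closes nothing; BSD / E2 / crux L are
proved for NO curve by this. Row D2-seq (the Galois side: which skeleton, `Hsp` vs the θ-line cohomology, `X' ↔ Dψ.X`) is NOT touched.

WHAT. Notation of `…RttD2SpecialisationHK` (`𝒪 = padicCoeffIntegers S`, `Λ_𝒪 = IwasawaAlgebraO S`, `R = PowerSeries Λ_𝒪 = 𝒪⟦T₂⟧⟦T₁⟧`, `f = C (X − C b)`,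
`φ`, `ι = PowerSeries.map C`), `Hsp := QuotSMulTop f H1` carrying the GLUE'S structures: any `Λ_𝒪`-module structure pinned by `l • x = (ι l) • x` (e.g. the
through-`φ` structure of `…RttD2SpecialisationDefs`, or restriction along `ι`), an `[Algebra Λ Λ_𝒪]` with `halg`, `[Module Λ Hsp]`, `[IsScalarTower Λ Λ_𝒪 Hsp]`.
* ★★ `lambdaInvariant_quotient_span_singleton_le_of_thm52Shape` — `D.Thm52Shape`, `¬ char_R(H2) ≤ (f)`, `torsionBy R (H1 ⧸ D.Z) f = ⊥`, and
  `(D.Z).map mk = R∙z` (the specialised zeta module is cyclic on `z : Hsp`) ⟹ `lambdaInvariant p (Hsp ⧸ Λ_𝒪∙z) ≤ lambdaInvariant p (QuotSMulTop f H2)` for any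
  `Λ`-structure on `QuotSMulTop f H2` pinned to `ι ∘ iwasawaToIwasawaO S` — i.e. the binder `hK` of `SmallImageRttCharRoad.charRoad_E2_of_parts` with `H := Hsp`,
  `Y := Ysp`. Ingredients: `Λ_𝒪∙z = R∙z` inside `Hsp` (`R` acts on `Hsp = H1/fH1` through `R/(f) = Λ_𝒪`: `r•x = ι(φ r)•x`), the swap
  `Hsp ⧸ Z̄ ≅ QuotSMulTop f (H1 ⧸ Z)` (p776060), `λ` along the resulting `Λ`-linear equivalence, and `lambdaInvariant_quotSMulTop_le_of_thm52Shape` (p776332).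
* `smul_eq_map_apply_smul_quotSMulTop` — the lemma `r • x = (ι (φ r)) • x` on `QuotSMulTop f M`; `span_singleton_eq_restrictScalars_span_singleton`.

References: [JohnsonLeungKings2011] Thm. 5.2, Cor. 5.3, Lemma 4.4; [Washington1997] §13.2; [BourbakiAC5to7] VII §4.5.
-/

set_option autoImplicit false
-- the Theorems namespace of this sub repeats the summit name by design (D-0017 nested layout)
set_option linter.dupNamespace false

noncomputable section

open scoped Pointwise
open PowerSeries Literature.NumberTheory.Automorphic Literature.NumberTheory.EllipticCurves Literature.NumberTheory.EllipticCurves.Module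
open Literature.NumberTheory.ComplexMultiplication.EllipticUnits.JohnsonLeungKings2011

namespace Summit.BirchSwinnertonDyer.BirchSwinnertonDyer.Theorems.SmallImageRttD2LamSpec

universe u v

section General

variable {A : Type u} [CommRing A] (b : A) (φ : PowerSeries (PowerSeries A) →+* PowerSeries A)
  (hC : ∀ a : A, φ (C (C a)) = C a) (hX : φ X = X) (hker : RingHom.ker φ = Ideal.span {C (X - C b)})

include hC hX hker in
/-- **`R` acts on `M/fM` through `R/(f) = 𝒪⟦T⟧`:** for `φ : 𝒪⟦T₂⟧⟦T₁⟧ → 𝒪⟦T⟧` with `φ (C (C a)) = C a`, `φ X = X`, `ker φ = (f)`, `f = C (X − C b)`, and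
`ι = PowerSeries.map C` (so `φ ∘ ι = id`): `r • x = (ι (φ r)) • x` on `QuotSMulTop f M` (`r − ι(φ r) ∈ ker φ = (f)` kills `M/fM`). [folklore] -/
theorem smul_eq_map_apply_smul_quotSMulTop (M : Type v) [AddCommGroup M] [Module (PowerSeries (PowerSeries A)) M]
    (r : PowerSeries (PowerSeries A)) (x : QuotSMulTop (C (X - C b) : PowerSeries (PowerSeries A)) M) :
    r • x = (PowerSeries.map (PowerSeries.C : A →+* PowerSeries A) (φ r)) • x := by
  have hmem : r - PowerSeries.map (PowerSeries.C : A →+* PowerSeries A) (φ r) ∈ RingHom.ker φ := by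
    rw [RingHom.mem_ker, map_sub, map_outer_eq_self_of_clauses' φ hC hX, sub_self]
  rw [hker, Ideal.mem_span_singleton] at hmem
  obtain ⟨c, hc⟩ := hmem
  obtain ⟨y, rfl⟩ := Submodule.Quotient.mk_surjective _ x
  have h0 : (r - PowerSeries.map (PowerSeries.C : A →+* PowerSeries A) (φ r)) •
      (Submodule.Quotient.mk y : QuotSMulTop (C (X - C b) : PowerSeries (PowerSeries A)) M) = 0 := by
    rw [hc, ← Submodule.Quotient.mk_smul, Submodule.Quotient.mk_eq_zero, mul_smul]
    exact Submodule.smul_mem_pointwise_smul _ _ _ Submodule.mem_top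
  rwa [sub_smul, sub_eq_zero] at h0

include hC hX hker in
/-- **`Λ_𝒪∙z = R∙z` inside `M/fM`** for any `Λ_𝒪 = 𝒪⟦T⟧`-structure on `QuotSMulTop f M` pinned by `l • x = (ι l) • x` (with the tower `Λ_𝒪 → R → M/fM` it
induces): the `Λ_𝒪`-span of `z` is the restriction of scalars of its `R`-span. [folklore] -/
theorem span_singleton_eq_restrictScalars_span_singleton (M : Type v) [AddCommGroup M] [Module (PowerSeries (PowerSeries A)) M]
    [Module (PowerSeries A) (QuotSMulTop (C (X - C b) : PowerSeries (PowerSeries A)) M)]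
    (hι : ∀ (l : PowerSeries A) (x : QuotSMulTop (C (X - C b) : PowerSeries (PowerSeries A)) M),
      l • x = (PowerSeries.map (PowerSeries.C : A →+* PowerSeries A) l) • x)
    [SMul (PowerSeries A) (PowerSeries (PowerSeries A))]
    [IsScalarTower (PowerSeries A) (PowerSeries (PowerSeries A)) (QuotSMulTop (C (X - C b) : PowerSeries (PowerSeries A)) M)]
    (z : QuotSMulTop (C (X - C b) : PowerSeries (PowerSeries A)) M) :
    Submodule.span (PowerSeries A) {z} = (Submodule.span (PowerSeries (PowerSeries A)) {z}).restrictScalars (PowerSeries A) := by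
  refine Submodule.ext fun x ↦ ?_
  simp only [Submodule.restrictScalars_mem, Submodule.mem_span_singleton]
  constructor
  · rintro ⟨l, rfl⟩
    exact ⟨PowerSeries.map (PowerSeries.C : A →+* PowerSeries A) l, (hι l z).symm⟩
  · rintro ⟨r, rfl⟩
    exact ⟨φ r, by rw [hι, smul_eq_map_apply_smul_quotSMulTop b φ hC hX hker M r z]⟩

end General

variable (p : ℕ) [Fact p.Prime] (S : Set (PadicAlgCl p)) [FiniteDimensional ℚ_[p] (padicCoeffField S)]
  (b : padicCoeffIntegers S) (φ : PowerSeries (IwasawaAlgebraO S) →+* IwasawaAlgebraO S)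
  (hφf : φ (C (X - C b)) = 0) (hC : ∀ a : padicCoeffIntegers S, φ (C (C a)) = C a) (hX : φ X = X)
  (hker : RingHom.ker φ = Ideal.span {C (X - C b)})

include hφf hC hX hker in
/-- ★★ **The glue's `hK` from `Thm52Shape` on road D (cyclic specialised zeta module).** In the setting of
`lambdaInvariant_quotSMulTop_le_of_thm52Shape` (`D.Thm52Shape`, `f`-regularity, defect `torsionBy R (H1 ⧸ D.Z) f = ⊥`), let `Hsp = QuotSMulTop f H1` carry
a `Λ_𝒪`-structure pinned by `l • x = (ι l) • x`, the glue's `[Algebra Λ Λ_𝒪]` (`halg`), `[Module Λ Hsp]`, `[IsScalarTower Λ Λ_𝒪 Hsp]`, let `QuotSMulTop f H2`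
carry a `Λ`-structure pinned to `ι ∘ iwasawaToIwasawaO S`, and suppose the specialised zeta module is cyclic: `(D.Z).map mk = R∙z`. Then
`lambdaInvariant p (Hsp ⧸ Λ_𝒪∙z) ≤ lambdaInvariant p (QuotSMulTop f H2)` — the binder `hK` of `charRoad_E2_of_parts` with `H := Hsp`, `Y := Ysp`.
[cite: JohnsonLeungKings2011, Thm. 5.2, Cor. 5.3, Lemma 4.4] [cite: Washington1997, §13.2] -/
theorem lambdaInvariant_quotient_span_singleton_le_of_thm52Shape {Aidx H0 H1 H2 : Type v} [AddCommGroup H0]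
    [Module (PowerSeries (IwasawaAlgebraO S)) H0] [AddCommGroup H1] [Module (PowerSeries (IwasawaAlgebraO S)) H1] [AddCommGroup H2]
    [Module (PowerSeries (IwasawaAlgebraO S)) H2] [Module.Finite (PowerSeries (IwasawaAlgebraO S)) H1]
    [Module.Finite (PowerSeries (IwasawaAlgebraO S)) H2]
    (D : ZetaSkeleton (PowerSeries (IwasawaAlgebraO S)) Aidx H0 H1 H2) (h52 : D.Thm52Shape)
    (hreg : ¬ charIdeal (PowerSeries (IwasawaAlgebraO S)) H2 ≤ Ideal.span {(C (X - C b) : PowerSeries (IwasawaAlgebraO S))})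
    (hdef : Submodule.torsionBy (PowerSeries (IwasawaAlgebraO S)) (H1 ⧸ D.Z) (C (X - C b)) = ⊥)
    [Module (IwasawaAlgebraO S) (QuotSMulTop (C (X - C b) : PowerSeries (IwasawaAlgebraO S)) H1)]
    (hιH : ∀ (l : IwasawaAlgebraO S) (x : QuotSMulTop (C (X - C b) : PowerSeries (IwasawaAlgebraO S)) H1),
      l • x = (PowerSeries.map (PowerSeries.C : padicCoeffIntegers S →+* IwasawaAlgebraO S) l) • x)
    [Algebra (IwasawaAlgebra p) (IwasawaAlgebraO S)]
    (halg : ∀ r : IwasawaAlgebra p, algebraMap (IwasawaAlgebra p) (IwasawaAlgebraO S) r = iwasawaToIwasawaO S r)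
    [Module (IwasawaAlgebra p) (QuotSMulTop (C (X - C b) : PowerSeries (IwasawaAlgebraO S)) H1)]
    [IsScalarTower (IwasawaAlgebra p) (IwasawaAlgebraO S) (QuotSMulTop (C (X - C b) : PowerSeries (IwasawaAlgebraO S)) H1)]
    [Module (IwasawaAlgebra p) (QuotSMulTop (C (X - C b) : PowerSeries (IwasawaAlgebraO S)) H2)]
    (hΛ2 : ∀ (r : IwasawaAlgebra p) (x : QuotSMulTop (C (X - C b) : PowerSeries (IwasawaAlgebraO S)) H2),
      r • x = (PowerSeries.map (PowerSeries.C : padicCoeffIntegers S →+* IwasawaAlgebraO S) (iwasawaToIwasawaO S r)) • x)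
    (z : QuotSMulTop (C (X - C b) : PowerSeries (IwasawaAlgebraO S)) H1)
    (hz : (D.Z).map ((C (X - C b) : PowerSeries (IwasawaAlgebraO S)) • (⊤ : Submodule (PowerSeries (IwasawaAlgebraO S)) H1)).mkQ =
      Submodule.span (PowerSeries (IwasawaAlgebraO S)) {z}) :
    lambdaInvariant p (QuotSMulTop (C (X - C b) : PowerSeries (IwasawaAlgebraO S)) H1 ⧸ Submodule.span (IwasawaAlgebraO S) {z}) ≤
      lambdaInvariant p (QuotSMulTop (C (X - C b) : PowerSeries (IwasawaAlgebraO S)) H2) := by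
  -- `Λ_𝒪 → R` the outer embedding `ι`; towers
  letI algι : Algebra (IwasawaAlgebraO S) (PowerSeries (IwasawaAlgebraO S)) :=
    (PowerSeries.map (PowerSeries.C : padicCoeffIntegers S →+* IwasawaAlgebraO S)).toAlgebra
  haveI : IsScalarTower (IwasawaAlgebraO S) (PowerSeries (IwasawaAlgebraO S))
      (QuotSMulTop (C (X - C b) : PowerSeries (IwasawaAlgebraO S)) H1) :=
    IsScalarTower.of_algebraMap_smul fun l x ↦ (hιH l x).symm
  letI i1 : Module (IwasawaAlgebraO S) (H1 ⧸ D.Z) :=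
    Module.compHom (H1 ⧸ D.Z) (PowerSeries.map (PowerSeries.C : padicCoeffIntegers S →+* IwasawaAlgebraO S))
  haveI : IsScalarTower (IwasawaAlgebraO S) (PowerSeries (IwasawaAlgebraO S)) (H1 ⧸ D.Z) := IsScalarTower.of_algebraMap_smul fun _ _ ↦ rfl
  -- the `Λ`-structure on `M₀ = QuotSMulTop f (H1 ⧸ D.Z)` through `ι ∘ (Λ → Λ_𝒪)`
  letI iΛ : Module (IwasawaAlgebra p) (QuotSMulTop (C (X - C b) : PowerSeries (IwasawaAlgebraO S)) (H1 ⧸ D.Z)) :=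
    Module.compHom _ ((PowerSeries.map (PowerSeries.C : padicCoeffIntegers S →+* IwasawaAlgebraO S)).comp (iwasawaToIwasawaO S))
  have step1 := lambdaInvariant_quotSMulTop_le_of_thm52Shape p S b φ hφf hC hX hker D h52 hreg hdef (fun _ _ ↦ rfl) hΛ2
  haveI : IsScalarTower (IwasawaAlgebra p) (IwasawaAlgebraO S) (QuotSMulTop (C (X - C b) : PowerSeries (IwasawaAlgebraO S)) (H1 ⧸ D.Z)) :=
    IsScalarTower.of_algebraMap_smul fun r x ↦ by
      rw [halg]
      exact IsScalarTower.algebraMap_smul (PowerSeries (IwasawaAlgebraO S)) (iwasawaToIwasawaO S r) x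
  -- `Λ_𝒪∙z = R∙z`, then `Hsp ⧸ Λ_𝒪∙z ≃ₗ[Λ_𝒪] QuotSMulTop f (H1 ⧸ D.Z)`
  have hspan := span_singleton_eq_restrictScalars_span_singleton b φ hC hX hker H1 hιH z
  obtain ⟨e60⟩ := SmallImageRttD2Descent.nonempty_quotSMulTop_quotient_linearEquiv_quotient_map
    (C (X - C b) : PowerSeries (IwasawaAlgebraO S)) D.Z
  let E : (QuotSMulTop (C (X - C b) : PowerSeries (IwasawaAlgebraO S)) H1 ⧸ Submodule.span (IwasawaAlgebraO S) {z}) ≃ₗ[IwasawaAlgebraO S]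
      QuotSMulTop (C (X - C b) : PowerSeries (IwasawaAlgebraO S)) (H1 ⧸ D.Z) :=
    (Submodule.quotEquivOfEq _ _ hspan).trans
      ((Submodule.Quotient.restrictScalarsEquiv (IwasawaAlgebraO S) (Submodule.span (PowerSeries (IwasawaAlgebraO S)) {z})).trans
        (((Submodule.quotEquivOfEq _ _ hz.symm).trans e60.symm).restrictScalars (IwasawaAlgebraO S)))
  have hE : ∀ (r : IwasawaAlgebra p) (x : QuotSMulTop (C (X - C b) : PowerSeries (IwasawaAlgebraO S)) H1 ⧸
      Submodule.span (IwasawaAlgebraO S) {z}), E (r • x) = r • E x := fun r x ↦ by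
    rw [← IsScalarTower.algebraMap_smul (IwasawaAlgebraO S) r x, map_smul, IsScalarTower.algebraMap_smul]
  let EΛ : (QuotSMulTop (C (X - C b) : PowerSeries (IwasawaAlgebraO S)) H1 ⧸ Submodule.span (IwasawaAlgebraO S) {z}) ≃ₗ[IwasawaAlgebra p]
      QuotSMulTop (C (X - C b) : PowerSeries (IwasawaAlgebraO S)) (H1 ⧸ D.Z) :=
    { E.toAddEquiv with map_smul' := fun r x ↦ hE r x }
  rw [lambdaInvariant_eq_of_linearEquiv EΛ]
  exact step1

end Summit.BirchSwinnertonDyer.BirchSwinnertonDyer.Theorems.SmallImageRttD2LamSpec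

end
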